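import Mathlib
import HarnessLib

/-!
# Route `RadicialJung`, crux `CleanModels` (stmt-ResolutionOfSingularities-15917), line `Sketch` rev 20, stub 4e
# `stub_cleanPrincipalization3`: NEAR CORNER CHAINS ARE CONFINED TO THE DOUBLE CURVE (the combinatorial core of memo §4 (4)/(4′))

Seat res-B-princ3 g1.  The research residue X44c of stub 4e (memo `Cruxes/CleanModels/Lines/Sketch-memo-4e-cleanPermissible.md`, §4) asks
whether the point blow-ups INSERTED at the non-clean-permissible points of a maximal-order curve can cascade for ever.  Every cascade found
there is a CORNER CHAIN: a sequence of closed points `q = q₀ ← q₁ ← q₂ ← ⋯`, `q_{i+1}` a torus-fixed point («corner») of the exceptional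
plane of the blowing up of `q_i`, for the torus of a regular system of parameters `(x, y, w)` at `q` in which the two charged clean components
are `V(x)`, `V(y)` and the directrix of the idealistic exponent `(J, μ)` is `V(λX + μ'Y)`, `λμ' ≠ 0` — so that `x^μ` and `y^μ` both occur in
an element of `J` of order `μ`.  The open item (4′) of the memo was whether such a chain can SWITCH corners infinitely often.

This file settles the combinatorics, with NO scheme theory: it is the dictionary-free core, to be fed later by the toric bookkeeping of the
controlled transform (the scheme-level dictionary below is NOT formalized here and nothing in this file closes 4e).

DICTIONARY (informal, for the reader; [cite: CossartPiltant2008, Lemma 4.3 and (11)] for the weak transform, toric folklore otherwise).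
Corners over `q` ↔ unimodular cones `σ = ⟨v₀, v₁, v₂⟩ ⊂ ℕ³` obtained from the orthant by iterated stellar subdivision: blowing up the corner
of `σ` creates the exceptional divisor with monomial valuation `s_σ = v₀ + v₁ + v₂` (`cornerSum`), and the three corners on it are the cones
`σ_k` replacing `v_k` by `s_σ` (`cornerGens (k :: w)`).  For `f = Σ c_m x^m ∈ κ[[x,y,w]]` (a coefficient field exists: equal characteristic)
monomials do not cancel under the unimodular monomial substitution, so the order at the corner of `σ` of the total transform of `J` is
`h_N(s_σ) = min_{m ∈ N} ⟨s_σ, m⟩` (`newtonMin`, `N` = the finite set of exponents of generators, equivalently the vertices of the Newton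
polyhedron), and the controlled transform `J_σ` (`J𝒪 = J_σ · ∏ E_j^{μ}` pulled back) has `ord J_σ = h_N(s_σ) − μ(|s_σ| − 3)/2`
(induction: the discount of a new exceptional divisor is `μ` plus the discounts of the exceptional generators kept).  Hence
NEARNESS (`ord = μ`, equivalently `≥ μ` since the order never exceeds `μ` after permissible blow-ups) of the corner of `σ` is
`2 h_N(s_σ) + μ ≥ μ |s_σ|` (`CornerNear`).  The corner reached by the constant path `2,2,2,…` is the point of the strict transform of the
double curve `D = V(x, y)`.

RESULTS.
* `cornerNear_confined`: if `μ e₀, μ e₁ ∈ N` (both `x^μ`, `y^μ` occur) and `μ ≥ 1`, every near corner is reached by a constant path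
  `2,2,…,2` — i.e. ALL near corners over `q`, at every level and for every choice of corners, lie on the strict transform of `D`; in
  particular a near corner chain never switches (memo (4′) settled: there is nothing to switch to).
* `cornerNear_replicate_of_forall` / `succ_le_of_cornerNear_replicate` / `forall_cornerNear_replicate_iff`: along `D` the chain is near
  at every level iff every exponent `m ∈ N` has `m₀ + m₁ ≥ μ` (i.e. `J ⊆ (x,y)^μ`, i.e. `D ⊆ Σ_μ` — then `D` itself is a clean-permissible
  centre), and otherwise its length is at most `m₂` for any witness `m` with `m₀ + m₁ < μ` (the «δ + 1» bound of the memo).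
* `exists_cornerNear_length_iff`: near corners exist at every level iff `∀ m ∈ N, μ ≤ m₀ + m₁`.

Honest framing: OURS, elementary; a combinatorial lemma supporting the termination analysis of the research stub 4e.  Nothing here proves
resolution of singularities in characteristic `p`, nor any case of `CleanModels`, nor 4e.
-/

set_option linter.dupNamespace false -- mandated namespace of this single-conjunct summit

namespace Summit.ResolutionOfSingularities.ResolutionOfSingularities.Theorems.RadicialJung.CleanModels

/-- The `j`-th standard basis vector of `ℕ³` (the monomial valuation of the `j`-th coordinate hyperplane at the starting point). [folklore] -/
def cornerBasis (j : Fin 3) : Fin 3 → ℕ := fun i => if i = j then 1 else 0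

/-- The sum of the three generators of a cone: the monomial valuation of the exceptional divisor created by blowing up its corner. [folklore] -/
def cornerSum (g : Fin 3 → (Fin 3 → ℕ)) : Fin 3 → ℕ := fun i => g 0 i + g 1 i + g 2 i

/-- The generators of the unimodular cone reached from the orthant by the path `w` of stellar subdivisions, read from the right: the step
`k` replaces the `k`-th generator by the sum of the current generators (= moving to the corner of the new exceptional plane where the
other two hyperplanes meet it). [folklore] -/
def cornerGens : List (Fin 3) → (Fin 3 → (Fin 3 → ℕ))
  | [] => cornerBasis
  | k :: w => Function.update (cornerGens w) k (cornerSum (cornerGens w))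

/-- The support function of the Newton polyhedron spanned by the nonempty finite exponent set `N`, evaluated at `s`: the order at the corner
with valuation vector `s` of the total transform of an ideal with exponent set `N`. [folklore] -/
def newtonMin (N : Finset (Fin 3 → ℕ)) (hN : N.Nonempty) (s : Fin 3 → ℕ) : ℕ :=
  N.inf' hN (fun m => s 0 * m 0 + s 1 * m 1 + s 2 * m 2)

/-- Nearness of the corner reached by the path `w` for the idealistic exponent with exponent set `N` and order `μ`: the controlled transform
still has order (at least) `μ` there, i.e. `h_N(s) ≥ μ(|s| − 1)/2`, written division-free as `μ|s| ≤ 2 h_N(s) + μ`. [folklore] -/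
def CornerNear (μ : ℕ) (N : Finset (Fin 3 → ℕ)) (hN : N.Nonempty) (w : List (Fin 3)) : Prop :=
  μ * (cornerSum (cornerGens w) 0 + cornerSum (cornerGens w) 1 + cornerSum (cornerGens w) 2) ≤
    2 * newtonMin N hN (cornerSum (cornerGens w)) + μ

/-- One stellar step doubles the valuation sum up to the replaced generator: `s' + v_k = 2 s`. [folklore] -/
theorem cornerSum_cons_add (k : Fin 3) (w : List (Fin 3)) (i : Fin 3) :
    cornerSum (cornerGens (k :: w)) i + cornerGens w k i = 2 * cornerSum (cornerGens w) i := by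
  fin_cases k <;> simp [cornerGens, cornerSum] <;> ring

/-- Each generator is bounded by the sum of the generators. [folklore] -/
theorem cornerGens_le_cornerSum (w : List (Fin 3)) (j i : Fin 3) :
    cornerGens w j i ≤ cornerSum (cornerGens w) i := by
  fin_cases j <;> simp [cornerSum] <;> omega

/-- Along the constant path `2,2,…` (the corners on the strict transform of the double curve `V(x,y)`) the first two generators stay `e₀, e₁`
and the third is `(n, n, 1)`. [folklore] -/
theorem cornerGens_replicate (n : ℕ) :
    cornerGens (List.replicate n 2) 0 = cornerBasis 0 ∧ cornerGens (List.replicate n 2) 1 = cornerBasis 1 ∧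
      cornerGens (List.replicate n 2) 2 = fun i => if i = 2 then 1 else n := by
  induction n with
  | zero =>
    refine ⟨rfl, rfl, ?_⟩
    funext i
    fin_cases i <;> simp [cornerGens, cornerBasis]
  | succ n ih =>
    obtain ⟨h0, h1, h2⟩ := ih
    rw [List.replicate_succ]
    refine ⟨?_, ?_, ?_⟩
    · simp [cornerGens, h0]
    · simp [cornerGens, h1]
    · funext i
      simp only [cornerGens, Function.update_self, cornerSum, h0, h1, h2, cornerBasis]
      fin_cases i <;> simp <;> omega

/-- The valuation vector of the `n`-th corner on the double curve is `(n+1, n+1, 1)`. [folklore] -/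
theorem cornerSum_replicate (n : ℕ) (i : Fin 3) :
    cornerSum (cornerGens (List.replicate n 2)) i = if i = 2 then 1 else n + 1 := by
  obtain ⟨h0, h1, h2⟩ := cornerGens_replicate n
  simp only [cornerSum, h0, h1, h2, cornerBasis]
  fin_cases i <;> simp <;> omega

/-- The third coordinate of the valuation sum is always at least `1`. [folklore] -/
theorem one_le_cornerSum_two (w : List (Fin 3)) : 1 ≤ cornerSum (cornerGens w) 2 := by
  induction w with
  | nil => simp [cornerGens, cornerSum, cornerBasis]
  | cons k w ih =>
    have h := cornerSum_cons_add k w 2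
    have h' := cornerGens_le_cornerSum w k 2
    omega

/-- KEY COUNT: as soon as the path leaves the double curve (some step `k ≠ 2`), the third coordinate of the valuation sum is at least `2`, at
that level and at every deeper level. [folklore] -/
theorem two_le_cornerSum_two (w : List (Fin 3)) (hw : ∃ k ∈ w, k ≠ 2) : 2 ≤ cornerSum (cornerGens w) 2 := by
  induction w with
  | nil => simp at hw
  | cons k w ih =>
    have hstep := cornerSum_cons_add k w 2
    have hle := cornerGens_le_cornerSum w k 2
    by_cases hw' : ∃ k' ∈ w, k' ≠ 2
    · have := ih hw'
      omega
    · push Not at hw'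
      have hwrep : w = List.replicate w.length 2 := List.eq_replicate_iff.mpr ⟨rfl, hw'⟩
      have hk : k ≠ 2 := by
        obtain ⟨k', hk', hk'2⟩ := hw
        rcases List.mem_cons.mp hk' with h | h
        · exact h ▸ hk'2
        · exact absurd (hw' k' h) hk'2
      obtain ⟨h0, h1, -⟩ := cornerGens_replicate w.length
      have hS : cornerSum (cornerGens w) 2 = 1 := by
        rw [hwrep, cornerSum_replicate]; simp
      have hg : cornerGens w k 2 = 0 := by
        have hk01 : k = 0 ∨ k = 1 := by omega
        rcases hk01 with rfl | rfl
        · rw [hwrep, h0]; simp [cornerBasis]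
        · rw [hwrep, h1]; simp [cornerBasis]
      omega

/-- The support function is bounded by its value at any exponent of the set. [folklore] -/
theorem newtonMin_le {N : Finset (Fin 3 → ℕ)} (hN : N.Nonempty) (s : Fin 3 → ℕ) {m : Fin 3 → ℕ} (hm : m ∈ N) :
    newtonMin N hN s ≤ s 0 * m 0 + s 1 * m 1 + s 2 * m 2 :=
  Finset.inf'_le _ hm

/-- A uniform lower bound on the pairing is a lower bound of the support function. [folklore] -/
theorem le_newtonMin {N : Finset (Fin 3 → ℕ)} (hN : N.Nonempty) (s : Fin 3 → ℕ) {a : ℕ}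
    (h : ∀ m ∈ N, a ≤ s 0 * m 0 + s 1 * m 1 + s 2 * m 2) : a ≤ newtonMin N hN s :=
  Finset.le_inf' _ _ h

/-- **Confinement of near corners (memo §4 (4′) settled).**  If `x^μ` and `y^μ` both occur (`μe₀, μe₁ ∈ N`) and `μ ≥ 1`, then a corner over
`q` at which the controlled transform is still near is reached by a constant path `2,2,…,2`: every near corner, at every level and for every
choice of corners, lies on the strict transform of the double curve `D = V(x,y)`.  Proof: nearness gives `μ|s| ≤ 2h_N(s) + μ ≤ μ s₀ + μ s₁ + μ`,
so `s₂ ≤ 1`, while leaving `D` forces `s₂ ≥ 2` (`two_le_cornerSum_two`). [folklore] -/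
theorem cornerNear_confined {μ : ℕ} (hμ : 0 < μ) {N : Finset (Fin 3 → ℕ)} (hN : N.Nonempty)
    (hx : (fun i : Fin 3 => if i = 0 then μ else 0) ∈ N) (hy : (fun i : Fin 3 => if i = 1 then μ else 0) ∈ N)
    (w : List (Fin 3)) (hnear : CornerNear μ N hN w) : ∀ k ∈ w, k = 2 := by
  by_contra hcon
  push Not at hcon
  have h2 : 2 ≤ cornerSum (cornerGens w) 2 := two_le_cornerSum_two w hcon
  set s := cornerSum (cornerGens w) with hs
  have hx' := newtonMin_le hN s hx
  have hy' := newtonMin_le hN s hy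
  simp only [Fin.isValue, ↓reduceIte, one_ne_zero, mul_zero, add_zero, Fin.reduceEq, zero_add] at hx' hy'
  unfold CornerNear at hnear
  rw [← hs] at hnear
  have hsum : μ * (s 0 + s 1 + s 2) = μ * s 0 + μ * s 1 + μ * s 2 := by ring
  have hle : μ * s 2 ≤ μ * 1 := by
    have : μ * s 0 + μ * s 1 + μ * s 2 ≤ s 0 * μ + s 1 * μ + μ := by
      calc μ * s 0 + μ * s 1 + μ * s 2 = μ * (s 0 + s 1 + s 2) := hsum.symm
        _ ≤ 2 * newtonMin N hN s + μ := hnear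
        _ ≤ s 0 * μ + s 1 * μ + μ := by omega
    have h0 : μ * s 0 = s 0 * μ := mul_comm _ _
    have h1 : μ * s 1 = s 1 * μ := mul_comm _ _
    omega
  have : s 2 ≤ 1 := Nat.le_of_mul_le_mul_left hle hμ
  omega

/-- If every exponent has `m₀ + m₁ ≥ μ` (i.e. `J ⊆ (x,y)^μ`: the double curve lies in the maximal-order locus), every corner on the double curve
is near. [folklore] -/
theorem cornerNear_replicate_of_forall {μ : ℕ} {N : Finset (Fin 3 → ℕ)} (hN : N.Nonempty)
    (h : ∀ m ∈ N, μ ≤ m 0 + m 1) (n : ℕ) : CornerNear μ N hN (List.replicate n 2) := by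
  unfold CornerNear
  have hS := cornerSum_replicate n
  simp only [hS, Fin.isValue, Fin.reduceEq, ↓reduceIte]
  have hmin : (n + 1) * μ ≤ newtonMin N hN (cornerSum (cornerGens (List.replicate n 2))) := by
    apply le_newtonMin
    intro m hm
    simp only [hS, Fin.isValue, Fin.reduceEq, ↓reduceIte, one_mul]
    have := h m hm
    nlinarith
  nlinarith

/-- **Length bound along the double curve.**  If some exponent `m ∈ N` has `m₀ + m₁ < μ` (the double curve is NOT in the maximal-order locus),
the `n`-th corner on the double curve can be near only for `n + 1 ≤ m₂`: the chain of insertions walking down `D` has length at most `m₂`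
(the «δ + 1» bound of the memo, §4 (4)). [folklore] -/
theorem succ_le_of_cornerNear_replicate {μ : ℕ} {N : Finset (Fin 3 → ℕ)} (hN : N.Nonempty) {m : Fin 3 → ℕ} (hm : m ∈ N)
    (hlt : m 0 + m 1 < μ) {n : ℕ} (hnear : CornerNear μ N hN (List.replicate n 2)) : n + 1 ≤ m 2 := by
  unfold CornerNear at hnear
  have hS := cornerSum_replicate n
  have hle := newtonMin_le hN (cornerSum (cornerGens (List.replicate n 2))) hm
  simp only [hS, Fin.isValue, Fin.reduceEq, ↓reduceIte, one_mul] at hnear hle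
  by_contra hcon
  push Not at hcon
  -- `μ(2n+3) ≤ 2((n+1)(m₀+m₁) + m₂) + μ` with `m₀ + m₁ + 1 ≤ μ` and `m₂ ≤ n` is impossible
  have h1 : μ * (n + 1 + (n + 1) + 1) ≤ 2 * ((n + 1) * m 0 + (n + 1) * m 1 + m 2) + μ := le_trans hnear (by omega)
  nlinarith

/-- **Dichotomy along the double curve.**  The corners on the strict transform of `D = V(x,y)` are near at every level iff every exponent has
`m₀ + m₁ ≥ μ` (`J ⊆ (x,y)^μ`, `D ⊆ Σ_μ`). [folklore] -/
theorem forall_cornerNear_replicate_iff {μ : ℕ} {N : Finset (Fin 3 → ℕ)} (hN : N.Nonempty) :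
    (∀ n, CornerNear μ N hN (List.replicate n 2)) ↔ ∀ m ∈ N, μ ≤ m 0 + m 1 := by
  refine ⟨fun h m hm => ?_, fun h n => cornerNear_replicate_of_forall hN h n⟩
  by_contra hlt
  push Not at hlt
  have := succ_le_of_cornerNear_replicate hN hm hlt (h (m 2))
  omega

/-- **Infinite near corner chains exist iff the double curve lies in the maximal-order locus.**  With `x^μ, y^μ` occurring and `μ ≥ 1`: there are
near corners at every level (for SOME choices of corners) iff `∀ m ∈ N, μ ≤ m₀ + m₁` — by confinement the only candidates are the corners on
`D`, and along `D` the dichotomy applies.  This is the statement «forced corner chains are finite unless the double curve lies in `Σ_μ`» of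
memo rev 10 §4, for the cascades of type (i), WITHOUT the forcing rule (which is therefore not needed). [folklore] -/
theorem exists_cornerNear_length_iff {μ : ℕ} (hμ : 0 < μ) {N : Finset (Fin 3 → ℕ)} (hN : N.Nonempty)
    (hx : (fun i : Fin 3 => if i = 0 then μ else 0) ∈ N) (hy : (fun i : Fin 3 => if i = 1 then μ else 0) ∈ N) :
    (∀ n, ∃ w : List (Fin 3), w.length = n ∧ CornerNear μ N hN w) ↔ ∀ m ∈ N, μ ≤ m 0 + m 1 := by
  refine ⟨fun h => (forall_cornerNear_replicate_iff hN).mp fun n => ?_,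
    fun h n => ⟨List.replicate n 2, List.length_replicate, cornerNear_replicate_of_forall hN h n⟩⟩
  obtain ⟨w, hlen, hnear⟩ := h n
  have hall := cornerNear_confined hμ hN hx hy w hnear
  have hw : w = List.replicate n 2 := List.eq_replicate_iff.mpr ⟨hlen, hall⟩
  exact hw ▸ hnear

end Summit.ResolutionOfSingularities.ResolutionOfSingularities.Theorems.RadicialJung.CleanModels
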